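import Mathlib
import Summits.ValiantsHypothesis.ValiantsHypothesis.Theorems.RigidityForcesSymmetryRankRigidMinimalReprLaplaceFourDefs
import Summits.ValiantsHypothesis.ValiantsHypothesis.Theorems.RigidityForcesSymmetryRankRigidMinimalReprLaplaceFourContraction

/-!
# The profiles `(5,0,0)` and `slice + (4,0,0)` of `LaplaceOptimal 4`: six independent contractions in a small span
# (crux `RankRigidMinimalRepr`, stmt-ValiantsHypothesis-18034, route `RigidityForcesSymmetry`)

Two of the nine one-slice-or-less profiles of the exact analysis of `LaplaceOptimal 4` die by a plain dimension count
(the «Laplace expansion along a 2-set is tight» phenomenon).  The six contractions `Q_{e_x,e_y}` (`x < y`) of the pattern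
are the six matrices `E^{zw}` (`{z,w}` the complement of `{x,y}`), which are linearly independent
(`six_contractions_independent`); hence they do not fit in a subspace of dimension `≤ 5` (`six_contractions_not_in_span`).

* `profile_500` — five pair terms on ONE matching (canonical position: all `S_t = {0,1}`): every `Q_{ψ,φ}` lies in the
  span of the five fixed matrices of the terms.
* `profile_400s` — one slice at slot `0` and four pair terms on `01|23`: for each pair `{a,b}` a vector
  `ψ ∈ ker f ∩ span{e_a,e_b}` kills the slice, and `Q_{ψ,e_a}`, `Q_{ψ,e_b}` recover `E^{\overline{ab}}` inside the span of
  the four term matrices.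

HONEST FRAMING: finite linear algebra toward `LaplaceOptimal 4` (rung `TiedTorusBound 3`); the crux stays OPEN; nothing
here bears on `VP ≠ VNP`.
-/

set_option autoImplicit false

-- the mandated summit-side namespace repeats a component by design (single-problem summit)
set_option linter.dupNamespace false

namespace Summit.ValiantsHypothesis.ValiantsHypothesis.Theorems.RigidityForcesSymmetryRankRigidMinimalRepr

namespace LaplaceFourFlat

open Module Matrix LaplaceFourContraction

/-! ### §1 Six independent contractions -/

/-- The six basic contractions, indexed by `Fin 6`: `(x,y) = (0,1),(0,2),(0,3),(1,2),(1,3),(2,3)`. -/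
theorem six_pairs_entries (ψ φ : Fin 4 → ℂ) :
    contract₀₁ permPattern₄ ψ φ 2 3 = ψ 0 * φ 1 + ψ 1 * φ 0 ∧ contract₀₁ permPattern₄ ψ φ 1 3 = ψ 0 * φ 2 + ψ 2 * φ 0 ∧
    contract₀₁ permPattern₄ ψ φ 1 2 = ψ 0 * φ 3 + ψ 3 * φ 0 ∧ contract₀₁ permPattern₄ ψ φ 0 3 = ψ 1 * φ 2 + ψ 2 * φ 1 ∧
    contract₀₁ permPattern₄ ψ φ 0 2 = ψ 1 * φ 3 + ψ 3 * φ 1 ∧ contract₀₁ permPattern₄ ψ φ 0 1 = ψ 2 * φ 3 + ψ 3 * φ 2 := by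
  rw [contract_permPattern_entries]; simp

/-- **Six independent contractions.**  A subspace of `4 × 4` matrices of dimension `≤ 5` cannot contain the six
contractions `Q_{e_x,e_y}`, `x < y`, of the pattern (they are the six independent matrices `E^{\overline{xy}}`). -/
theorem six_contractions_not_in_span (W : Submodule ℂ (Matrix (Fin 4) (Fin 4) ℂ)) (hW : finrank ℂ W ≤ 5)
    (h : ∀ x y : Fin 4, x ≠ y → contract₀₁ permPattern₄ (Pi.single x 1) (Pi.single y 1) ∈ W) : False := by
  let pr : Fin 6 → Fin 4 × Fin 4 := ![(0, 1), (0, 2), (0, 3), (1, 2), (1, 3), (2, 3)]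
  have hpr : ∀ i, (pr i).1 ≠ (pr i).2 := by decide
  let v : Fin 6 → W := fun i =>
    ⟨contract₀₁ permPattern₄ (Pi.single (pr i).1 1) (Pi.single (pr i).2 1), h _ _ (hpr i)⟩
  have hind : LinearIndependent ℂ v := by
    apply LinearIndependent.of_comp W.subtype
    rw [Fintype.linearIndependent_iff]
    intro g hg i
    have hmat : ∑ i, g i • contract₀₁ permPattern₄ (Pi.single (pr i).1 (1 : ℂ)) (Pi.single (pr i).2 1) = 0 := by
      simpa [v] using hg
    have e := fun z w => congrFun (congrFun hmat z) w
    have e23 := e 2 3; have e13 := e 1 3; have e12 := e 1 2; have e03 := e 0 3; have e02 := e 0 2; have e01 := e 0 1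
    simp [Fin.sum_univ_six, Matrix.sum_apply, contract_permPattern_entries, pr,
      Pi.single_apply] at e23 e13 e12 e03 e02 e01
    fin_cases i <;> assumption
  have := hind.fintype_card_le_finrank
  simp at this
  omega

/-! ### §2 The profile `(5,0,0)` -/

/-- **Profile `(5,0,0)`**: at most five pair terms on the matching `01|23` (canonical sets `S_t = {0,1}`) never sum to the
pattern — the flattening rank of `P₄` along `01|23` is `6`. -/
theorem profile_500 {ι : Type*} (T : Finset ι) (X : ι → (Fin 4 → Fin 4) → ℂ)
    (hX : ∀ t ∈ T, IsSplitTerm {0, 1} (X t)) (hT : T.card ≤ 5)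
    (hsum : ∀ v, permPattern₄ v = ∑ t ∈ T, X t v) : False := by
  classical
  have hN : ∀ t ∈ T, ∃ N : Matrix (Fin 4) (Fin 4) ℂ, ∀ ψ φ, ∃ c : ℂ, contract₀₁ (X t) ψ φ = c • N := by
    intro t ht
    obtain ⟨u, w, hu, hw, hX'⟩ := hX t ht
    obtain ⟨g, N, hN⟩ := contract_term_01 hu hw
    exact ⟨N, fun ψ φ => ⟨_, by rw [contract_congr hX', hN]⟩⟩
  choose! N hN using hN
  let W : Submodule ℂ (Matrix (Fin 4) (Fin 4) ℂ) := Submodule.span ℂ (T.image N : Set (Matrix (Fin 4) (Fin 4) ℂ))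
  refine six_contractions_not_in_span W ?_ fun x y _ => ?_
  · exact (finrank_span_finset_le_card (R := ℂ) (T.image N)).trans (Finset.card_image_le.trans hT)
  · rw [contract_congr hsum, contract_sum]
    refine Submodule.sum_mem _ fun t ht => ?_
    obtain ⟨c, hc⟩ := hN t ht (Pi.single x 1) (Pi.single y 1)
    rw [hc]
    exact Submodule.smul_mem _ _ (Submodule.subset_span (Finset.mem_image_of_mem N ht))

/-! ### §3 The profile `slice + (4,0,0)` -/

/-- `Q_{e_x, e_x} = 0`. -/
theorem contract_single_self (x : Fin 4) :
    contract₀₁ permPattern₄ (Pi.single x (1 : ℂ)) (Pi.single x 1) = 0 := by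
  rw [contract_permPattern_entries]
  ext i j
  fin_cases x <;> fin_cases i <;> fin_cases j <;> simp

/-- `Q` is linear in its first argument. -/
theorem contract_lin_left (a b : ℂ) (u u' φ : Fin 4 → ℂ) :
    contract₀₁ permPattern₄ (a • u + b • u') φ =
      a • contract₀₁ permPattern₄ u φ + b • contract₀₁ permPattern₄ u' φ := by
  rw [contract_permPattern_entries, contract_permPattern_entries, contract_permPattern_entries]
  ext i j; fin_cases i <;> fin_cases j <;> simp <;> ring

/-- A slice at slot `0` has a `φ`-independent killing functional: `(Σ_x ℓ_x ψ_x) · N(φ)`. -/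
theorem contract_term_0' {u w : (Fin 4 → Fin 4) → ℂ} (hu : DependsOnlyOn {0} u) (hw : DependsOnlyOn {0}ᶜ w) :
    ∃ ℓ : Fin 4 → ℂ, ∀ φ : Fin 4 → ℂ, ∃ N : Matrix (Fin 4) (Fin 4) ℂ, ∀ ψ : Fin 4 → ℂ,
      contract₀₁ (fun v => u v * w v) ψ φ = (∑ x, ℓ x * ψ x) • N := by
  refine ⟨fun x => u ![x, 0, 0, 0], fun φ => ⟨Matrix.of fun i j => ∑ y, φ y * w ![0, y, i, j], fun ψ => ?_⟩⟩
  ext i j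
  simp only [contract₀₁, Matrix.of_apply, Matrix.smul_apply, smul_eq_mul]
  have hu' : ∀ x y, u ![x, y, i, j] = u ![x, 0, 0, 0] := fun x y =>
    hu _ _ (fun k hk => by fin_cases k <;> simp at hk ⊢)
  have hw' : ∀ x y, w ![x, y, i, j] = w ![0, y, i, j] := fun x y =>
    hw _ _ (fun k hk => by fin_cases k <;> simp at hk ⊢)
  simp_rw [hu', hw']
  rw [Finset.sum_mul]
  refine Finset.sum_congr rfl fun x _ => ?_
  rw [Finset.mul_sum]
  exact Finset.sum_congr rfl fun y _ => by ring

/-- **Profile `slice + (4,0,0)`**: one slice at slot `0` (`S_t = {0}`) and at most four pair terms on `01|23`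
(`S_t = {0,1}`) never sum to the pattern. -/
theorem profile_400s {ι : Type*} (T : Finset ι) (X : ι → (Fin 4 → Fin 4) → ℂ) (S : ι → Finset (Fin 4))
    (hX : ∀ t ∈ T, IsSplitTerm (S t) (X t)) (hS : ∀ t ∈ T, S t = {0} ∨ S t = {0, 1})
    (h0 : (T.filter fun t => S t = {0}).card ≤ 1) (h01 : (T.filter fun t => S t = {0, 1}).card ≤ 4)
    (hsum : ∀ v, permPattern₄ v = ∑ t ∈ T, X t v) : False := by
  classical
  set T0 := T.filter fun t => S t = {0} with hT0
  set T1 := T.filter fun t => S t = {0, 1} with hT1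
  have hTsplit : T = T0 ∪ T1 := by
    ext t; simp only [hT0, hT1, Finset.mem_union, Finset.mem_filter]
    constructor
    · intro ht; rcases hS t ht with h | h
      · exact Or.inl ⟨ht, h⟩
      · exact Or.inr ⟨ht, h⟩
    · rintro (⟨ht, -⟩ | ⟨ht, -⟩) <;> exact ht
  have hdisj : Disjoint T0 T1 := by
    rw [hT0, hT1, Finset.disjoint_filter]; intro t _ h0' h1'; rw [h0'] at h1'
    exact absurd (congrArg Finset.card h1') (by decide)
  -- the slice's killing functional (or `0` if there is no slice)
  have hslice : ∃ ℓ : Fin 4 → ℂ, ∀ φ ψ : Fin 4 → ℂ, (∑ x, ℓ x * ψ x) = 0 →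
      ∑ t ∈ T0, contract₀₁ (X t) ψ φ = 0 := by
    rcases Nat.lt_or_ge T0.card 1 with h | h
    · have : T0 = ∅ := Finset.card_eq_zero.1 (by omega)
      exact ⟨0, fun φ ψ _ => by rw [this, Finset.sum_empty]⟩
    · obtain ⟨t, ht⟩ := Finset.card_eq_one.1 (show T0.card = 1 by omega)
      have htT : t ∈ T0 := by rw [ht]; exact Finset.mem_singleton_self t
      rw [hT0, Finset.mem_filter] at htT
      obtain ⟨u, w, hu, hw, hX'⟩ := hX t htT.1
      rw [htT.2] at hu hw
      obtain ⟨ℓ, hℓ⟩ := contract_term_0' hu hw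
      refine ⟨ℓ, fun φ ψ hψ => ?_⟩
      obtain ⟨N, hN⟩ := hℓ φ
      rw [ht, Finset.sum_singleton, contract_congr hX', hN, hψ, zero_smul]
  obtain ⟨ℓ, hℓ⟩ := hslice
  -- the pair terms' matrices
  have hN : ∀ t ∈ T1, ∃ N : Matrix (Fin 4) (Fin 4) ℂ, ∀ ψ φ, ∃ c : ℂ, contract₀₁ (X t) ψ φ = c • N := by
    intro t ht
    rw [hT1, Finset.mem_filter] at ht
    obtain ⟨u, w, hu, hw, hX'⟩ := hX t ht.1
    rw [ht.2] at hu hw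
    obtain ⟨g, N, hN⟩ := contract_term_01 hu hw
    exact ⟨N, fun ψ φ => ⟨_, by rw [contract_congr hX', hN]⟩⟩
  choose! N hN using hN
  let W : Submodule ℂ (Matrix (Fin 4) (Fin 4) ℂ) := Submodule.span ℂ (T1.image N : Set (Matrix (Fin 4) (Fin 4) ℂ))
  have hW : ∀ ψ φ : Fin 4 → ℂ, (∑ x, ℓ x * ψ x) = 0 → contract₀₁ permPattern₄ ψ φ ∈ W := by
    intro ψ φ hψ
    rw [contract_congr hsum, contract_sum, hTsplit, Finset.sum_union hdisj, hℓ φ ψ hψ, zero_add]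
    refine Submodule.sum_mem _ fun t ht => ?_
    obtain ⟨c, hc⟩ := hN t ht ψ φ
    rw [hc]
    exact Submodule.smul_mem _ _ (Submodule.subset_span (Finset.mem_image_of_mem N ht))
  refine six_contractions_not_in_span W ?_ fun x y hxy => ?_
  · exact (finrank_span_finset_le_card (R := ℂ) (T1.image N)).trans
      (Finset.card_image_le.trans (h01.trans (by norm_num)))
  · by_cases hx0 : ℓ x = 0
    · -- `ψ = e_x ∈ ker ℓ`, and `Q_{e_x, e_y}` itself lies in `W`
      exact hW (Pi.single x 1) (Pi.single y 1) (by simp [Pi.single_apply, hx0])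
    · -- `ψ = ℓ_y e_x - ℓ_x e_y ∈ ker ℓ`; `Q_{ψ, e_x} = -ℓ_x · Q_{e_y, e_x}`
      set ψ : Fin 4 → ℂ := ℓ y • (Pi.single x 1 : Fin 4 → ℂ) + (-ℓ x) • (Pi.single y 1 : Fin 4 → ℂ) with hψ
      have hker : (∑ z, ℓ z * ψ z) = 0 := by
        simp only [hψ, Pi.add_apply, Pi.smul_apply, Pi.single_apply, smul_eq_mul, mul_ite, mul_one,
          mul_zero, mul_add, Finset.sum_add_distrib, Finset.sum_ite_eq', Finset.mem_univ, if_true]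
        ring
      have h1 := hW ψ (Pi.single x 1) hker
      rw [hψ, contract_lin_left, contract_single_self, smul_zero, zero_add, contract_permPattern_swap] at h1
      have := W.smul_mem (-(ℓ x)⁻¹) h1
      rwa [smul_smul, show -(ℓ x)⁻¹ * -ℓ x = 1 by field_simp, one_smul] at this

end LaplaceFourFlat

end Summit.ValiantsHypothesis.ValiantsHypothesis.Theorems.RigidityForcesSymmetryRankRigidMinimalRepr
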